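import Literature.AnabelianGeometry.EtaleTheta.FrobenioidMonoThetaEnv
import Literature.AnabelianGeometry.EtaleTheta.Discharge.Sec5DegenerateDatumKummer

/-!
# [EtTh] §5, Theorem 5.10 (iii): the universal closure of the schema `MonoThetaEnvCompat` is refuted at the degenerate §5 datum (p. 334 / PDF p. 108)

Mochizuki, *The étale theta function and its Frobenioid-theoretic manifestations*, Publ. RIMS **45**
(2009) [cite: MochizukiEtTh2009, Thm 5.10 (iii) p.334 (PDF p.108)].  abc-iut cell, block F (fact-proving wave),
seat abc-iut-f-123 (tranche 123); PROOF-ONLY companion (theorems + toy data only) of abc-iut-L2-t4's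
`FrobenioidMonoThetaEnv.lean`, whose named fact
* `ThetaFrobenioid.MonoThetaEnvCompat h1 h3 hsec hcs h8 DK Ψ β ψY hbase hY hYdd` (FACT-LIST **F-0547**) — Theorem
  5.10 (iii): "The operation of applying `Ψ` followed by conjugation by `β` preserves the `Aut_C(B_N)`-orbit of
  `ϵ : E^Π_N → Aut_C(B_N)`, in a fashion which is compatible with the mono-theta environment structure on `E^Π_N` …
  there exists a commutative diagram … where `γ` … determines an automorphism of mono-theta environments and is
  compatible with the `Π^tp_X`-conjugacy class of automorphisms of `Π^tp_Y` induced by `Ψ^bs`" — typed over the §5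
  datum `𝔉`, the §5 inputs, the FREE residual Kummer part `DK ⊆ Out(E^Π_N)` of `D` (the typer's documented
  `TODO-merge` parameter, RQ7 finding F1), the self-equivalence `Ψ`, `β : Ψ(B_N) ⥲ B_N` and an automorphism `ψY` of
  `Π^tp_X̲` over `Ψ^Aut` stabilising `Π^tp_Y̲`, `Π^tp_Ÿ̲`,
is a SCHEMA (FACT-LIST R5), built on abc-iut-f-115's degenerate §5 datum `Sec5Toy.datum` (`Discharge/Sec5DegenerateDatum.lean`,
`…Kummer.lean`: one-object base, `Aut_C(B_N) = Aut_D(B_N^bs) = 1`, `Π^tp_X̲ = ℤ × ℤ × ℤ` discrete and abelian,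
`Π^tp_Y̲ = 0 × ℤ × ℤ`, `Π^tp_Ÿ̲ = 0 × ℤ × 2ℤ`, so that `E^Π_N ≅ Π^tp_Y̲ ≅ ℤ²` is abelian and `Out(E^Π_N) = Aut(E^Π_N)`).

PROVED here (all at `Sec5Toy.datum`):
* `Sec5Toy.shear` / `shearTop` — the unipotent automorphism `(a, b, c) ↦ (a, b + c, c)` of `Π^tp_X̲`; it stabilises
  `Π^tp_Y̲` and `Π^tp_Ÿ̲` (`map_PiY_shearTop`, `map_PiYdd_shearTop`) and lies over `Ψ^Aut` for every `Ψ`, `β`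
  (`hbase_datum`: `Aut_D(B_N^bs)` is trivial) — an admissible `ψY`;
* `Sec5Toy.negB` — the bi-continuous automorphism `(1, (0, b, c)) ↦ (1, (0, −b, c))` of `E^Π_N`, its class
  `negBOut ∈ Out(E^Π_N)`; `Sec5Toy.outLift : Out(E^Π_N) →* Aut(E^Π_N)` (inner automorphisms of the abelian `E^Π_N`
  are trivial) and the subgroup `fixOut ⊆ Out(E^Π_N)` of classes fixing `x₀ := (1, (0,0,1))`, which contains the
  whole of `D = ⟨galOut ∪ constOut ∪ {negBOut}⟩` (`closure_le_fixOut`);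
* **`Sec5Toy.not_monoThetaEnvCompat_datum`** — with `DK := {negBOut}`, `Ψ := 𝟭`, `β := 𝟙`, `ψY := shear` the typed
  Theorem 5.10 (iii) statement FAILS for ALL §5 inputs `h1 h3 hsec hcs h8`: the `ϵ`-clause is vacuous, the
  `Π^tp_Y`-clause forces `γ` to act as the shear on `E^Π_N ≅ Π^tp_Y̲`, and then "`γ` determines an automorphism of
  mono-theta environments" (`map_D`) would put `[shear ∘ negB ∘ shear⁻¹]` into `D ⊆ fixOut`, whereas
  `shear (negB (shear⁻¹ (0,0,1))) = (0,2,1) ≠ (0,0,1)`;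
* **`Sec5Toy.not_forall_monoThetaEnvCompat`** (F-0547) — the universal closure over (`C`, `D`, §5 data, §5 inputs,
  `DK`, `Ψ`, `β`, `ψY`, `hbase`, `hY`, `hYdd`) is FALSE;
* `Sec5Toy.monoThetaEnvCompat_datum_refl` — CONSISTENCY: at the same datum the statement HOLDS for `ψY := id` and every
  `DK`, `Ψ`, `β` (`γ := id`, `κ := 1`), so the predicate takes both truth values on the interface and the failure
  is located in the free pair (`DK`, `ψY`).
Instance forms of record (unchanged, conditional on the printed §5 inputs): abc-iut-L2's
`monoThetaEnvCompat_of_psiAutPreserves` (Sec5Thm510), `monoThetaEnvCompat_of_D_eq` (Sec5KummerPartAgreement),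
`monoThetaEnvCompat_canonical` / `…_of_cor218_i` (Sec5Thm510iiiKummerPart, canonical `DK₀`),
`monoThetaEnvCompat_kummerOut_iff…` (Sec5KummerOutCanonical / Sec5KummerGaloisDictionaryTransfers).  FACT-LIST R5:
named instances only.
HONEST FRAMING: a counterexample to the ∀-closure of a typed PREDICATE with free parameters, at a degenerate datum that
is NOT the tempered Frobenioid of a curve; nothing of [EtTh] is refuted or asserted (print's `D` has no free Kummer
part and print's `γ` exists by Thm. 5.10 (ii)); no FACT-LIST row is thereby proved; typed ≠ proved; refuting OUR
universal closure ≠ refuting print; nothing here bears on [IUTchIII] Cor. 3.12 and no side is taken on any disputed claim.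
-/

noncomputable section

namespace Literature.AnabelianGeometry.EtaleTheta

open CategoryTheory Literature.AlgebraicGeometry.Frobenioids

namespace Sec5Toy

/-! ### Elements of `E^Π_N` at the degenerate datum are determined by their `Π^tp_X̲`-coordinate -/

/-- At the degenerate datum (`Aut_C(B_N) = 1`) an element of `E^Π_N` is determined by its image under
`E^Π_N ↠ Π^tp_Y̲`.  [cite: MochizukiEtTh2009, Lem 5.9 (iv) p.332 (PDF p.106)] -/
theorem EPiN_ext {x y : datum.EPiN} (h : datum.toPiY x = datum.toPiY y) : x = y :=
  haveI := subsingleton_aut_BN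
  Subtype.ext (Prod.ext (Subsingleton.elim _ _) h)

/-- `(1, (0,0,1)) ∈ E^Π_N` for the datum. [cite: MochizukiEtTh2009, Lem 5.9 (iv) p.332 (PDF p.106)] -/
theorem one_a₀_mem_EPiN : ((1 : Aut datum.BN), (a₀ : datum.PiX)) ∈ datum.EPiN := by
  haveI := subsingleton_aut_base_BN
  refine ⟨Subgroup.one_mem _, ?_, Subsingleton.elim _ _⟩
  change a₀ ∈ datum.PiY
  rw [datum_PiY]
  exact a₀_mem

/-- The test point `x₀ := (1, (0,0,1)) ∈ E^Π_N`. [cite: MochizukiEtTh2009, Lem 5.9 (iv) p.332 (PDF p.106)] -/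
def x₀ : datum.EPiN := ⟨((1 : Aut datum.BN), (a₀ : datum.PiX)), one_a₀_mem_EPiN⟩

/-- `x₀ ↦ (0,0,1)` under `E^Π_N ↠ Π^tp_Y̲`. [cite: MochizukiEtTh2009, Lem 5.9 (iv) p.332 (PDF p.106)] -/
@[simp] theorem toPiY_x₀ : datum.toPiY x₀ = a₀ := rfl

/-! ### The shear `ψY : (a, b, c) ↦ (a, b + c, c)` of `Π^tp_X̲ = ℤ × ℤ × ℤ` -/

/-- The unipotent shear `(a, b, c) ↦ (a, b + c, c)` of `ℤ × ℤ × ℤ` (multiplicative notation), a group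
automorphism.  [cite: MochizukiEtTh2009, Thm 5.10 (iii) p.334 (PDF p.108)] -/
def shear : Pi ≃* Pi where
  toFun x := (x.1, (x.2.1 * x.2.2, x.2.2))
  invFun x := (x.1, (x.2.1 * x.2.2⁻¹, x.2.2))
  left_inv _ := by simp
  right_inv _ := by simp
  map_mul' _ _ := Prod.ext rfl (Prod.ext (mul_mul_mul_comm _ _ _ _) rfl)

/-- `shear` on elements. [cite: MochizukiEtTh2009, Thm 5.10 (iii) p.334 (PDF p.108)] -/
@[simp] theorem shear_apply (x : Pi) : shear x = (x.1, (x.2.1 * x.2.2, x.2.2)) := rfl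

/-- `shear⁻¹` on elements. [cite: MochizukiEtTh2009, Thm 5.10 (iii) p.334 (PDF p.108)] -/
@[simp] theorem shear_symm_apply (x : Pi) : shear.symm x = (x.1, (x.2.1 * x.2.2⁻¹, x.2.2)) := rfl

/-- `shear` does not change the first coordinate (so it stabilises `Π^tp_Y̲ = Ker(pr₁)`).
[cite: MochizukiEtTh2009, Thm 5.10 (iii) p.334 (PDF p.108)] -/
theorem zq_shear (x : Pi) : zq (shear x) = zq x := rfl

/-- `shear` does not change the third coordinate (so it stabilises `Π^tp_Ÿ̲`).
[cite: MochizukiEtTh2009, Thm 5.10 (iii) p.334 (PDF p.108)] -/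
theorem par_shear (x : Pi) : par (shear x) = par x := rfl

/-- The shear as an automorphism of the (discrete) topological group `Π^tp_X̲` of the datum — the `ψY` of the
counterexample.  [cite: MochizukiEtTh2009, Thm 5.10 (iii) p.334 (PDF p.108)] -/
def shearTop : datum.PiX ≃ₜ* datum.PiX :=
  haveI := discreteTopology_datum_PiX
  { (shear : datum.PiX ≃* datum.PiX) with
    continuous_toFun := continuous_of_discreteTopology
    continuous_invFun := continuous_of_discreteTopology }

/-- `shearTop` is `shear` on elements. [cite: MochizukiEtTh2009, Thm 5.10 (iii) p.334 (PDF p.108)] -/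
@[simp] theorem shearTop_apply (x : datum.PiX) : shearTop x = shear x := rfl

/-- A subgroup cut out by a homomorphism that `shear` leaves invariant is stabilised by `shear`.
[cite: MochizukiEtTh2009, Thm 5.10 (iii) p.334 (PDF p.108)] -/
theorem map_shearTop_eq_of_invariant (K : Subgroup datum.PiX)
    (hK : ∀ x : datum.PiX, shearTop x ∈ K ↔ x ∈ K) :
    K.map shearTop.toMulEquiv.toMonoidHom = K := by
  ext x
  constructor
  · rintro ⟨y, hy, rfl⟩
    exact (hK y).mpr hy
  · intro hx
    refine ⟨shearTop.symm x, (hK _).mp ?_, ?_⟩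
    · rwa [ContinuousMulEquiv.apply_symm_apply]
    · exact ContinuousMulEquiv.apply_symm_apply _ _

/-- `ψY := shear` stabilises `Π^tp_Y̲` (hypothesis `hY` of the typed Thm. 5.10 (iii)).
[cite: MochizukiEtTh2009, Thm 5.10 (iii) p.334 (PDF p.108)] -/
theorem map_PiY_shearTop : datum.PiY.map shearTop.toMulEquiv.toMonoidHom = datum.PiY := by
  apply map_shearTop_eq_of_invariant
  intro x
  rw [datum_PiY]
  exact Iff.rfl

/-- `ψY := shear` stabilises `Π^tp_Ÿ̲` (hypothesis `hYdd` of the typed Thm. 5.10 (iii)).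
[cite: MochizukiEtTh2009, Thm 5.10 (iii) p.334 (PDF p.108)] -/
theorem map_PiYdd_shearTop : datum.PiYdd.map shearTop.toMulEquiv.toMonoidHom = datum.PiYdd := by
  apply map_shearTop_eq_of_invariant
  intro x
  rw [datum_PiYdd]
  exact Iff.rfl

/-- At the degenerate datum EVERY `ψY` lies over EVERY `Ψ^Aut` through `ρ` (hypothesis `hbase` of the typed
Thm. 5.10 (iii)): `Aut_D(B_N^bs)` is trivial.  [cite: MochizukiEtTh2009, Thm 5.10 (iii) p.334 (PDF p.108)] -/
theorem hbase_datum (Ψ : Discrete PUnit.{1} ≌ Discrete PUnit.{1}) (β : Ψ.functor.obj datum.BN ≅ datum.BN)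
    (ψY : datum.PiX ≃ₜ* datum.PiX) (g : datum.PiX) :
    datum.autBase datum.BN (datum.psiAut Ψ β (datum.sgpCap (datum.ρ g))) = datum.ρ (ψY g) :=
  haveI := subsingleton_aut_base_BN
  Subsingleton.elim _ _

/-! ### The automorphism `negB : (1, (0, b, c)) ↦ (1, (0, −b, c))` of `E^Π_N` and its class in `Out(E^Π_N)` -/

/-- Negation of the middle coordinate, `(a, b, c) ↦ (a, −b, c)`, a group automorphism of `ℤ × ℤ × ℤ`.
[cite: MochizukiEtTh2009, Lem 5.9 (iv) p.332 (PDF p.106)] -/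
def negPi : Pi ≃* Pi where
  toFun x := (x.1, (x.2.1⁻¹, x.2.2))
  invFun x := (x.1, (x.2.1⁻¹, x.2.2))
  left_inv _ := by simp
  right_inv _ := by simp
  map_mul' _ _ := Prod.ext rfl (Prod.ext (mul_inv _ _) rfl)

/-- `negPi` on elements. [cite: MochizukiEtTh2009, Lem 5.9 (iv) p.332 (PDF p.106)] -/
@[simp] theorem negPi_apply (x : Pi) : negPi x = (x.1, (x.2.1⁻¹, x.2.2)) := rfl

/-- `negPi` preserves membership in `E^Π_N` (it does not change the first coordinate, and `Aut_D(B_N^bs) = 1`).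
[cite: MochizukiEtTh2009, Lem 5.9 (iv) p.332 (PDF p.106)] -/
theorem negPi_mem_EPiN (x : datum.EPiN) :
    ((x : Aut datum.BN × datum.PiX).1, (negPi (x : Aut datum.BN × datum.PiX).2 : datum.PiX)) ∈ datum.EPiN := by
  haveI := subsingleton_aut_base_BN
  obtain ⟨he, hy, -⟩ := x.2
  refine ⟨he, ?_, Subsingleton.elim _ _⟩
  rw [datum_PiY] at hy ⊢
  exact hy

/-- **`negB`**: the automorphism `(e, (a, b, c)) ↦ (e, (a, −b, c))` of the abelian group `E^Π_N` of the datum.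
[cite: MochizukiEtTh2009, Lem 5.9 (iv) p.332 (PDF p.106)] -/
def negB : MulAut datum.EPiN where
  toFun x := ⟨_, negPi_mem_EPiN x⟩
  invFun x := ⟨_, negPi_mem_EPiN x⟩
  left_inv _ := Subtype.ext (Prod.ext rfl (negPi.left_inv _))
  right_inv _ := Subtype.ext (Prod.ext rfl (negPi.left_inv _))
  map_mul' _ _ := Subtype.ext (Prod.ext rfl (map_mul negPi _ _))

/-- `negB` on the `Π^tp_X̲`-coordinate. [cite: MochizukiEtTh2009, Lem 5.9 (iv) p.332 (PDF p.106)] -/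
@[simp] theorem toPiY_negB (x : datum.EPiN) : datum.toPiY (negB x) = negPi (datum.toPiY x) := rfl

/-- `negB` is bi-continuous for the "evident topology" of `E^Π_N`.
[cite: MochizukiEtTh2009, Lem 5.9 (iv) p.332 (PDF p.106)] -/
theorem negB_mem_contMulAut : negB ∈ contMulAut datum.EPiN := by
  haveI := discreteTopology_datum_PiX
  exact ⟨ThetaFrobenioid.continuous_of_componentwise _ id (fun y : datum.PiX => (negPi y : Pi))
      continuous_of_discreteTopology fun _ => rfl,
    ThetaFrobenioid.continuous_of_componentwise _ id (fun y : datum.PiX => (negPi y : Pi))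
      continuous_of_discreteTopology fun _ => rfl⟩

/-- The class `[negB] ∈ Out(E^Π_N)` — the one-element Kummer part `DK` of the counterexample.
[cite: MochizukiEtTh2009, Lem 5.9 (iv) p.332 (PDF p.106)] -/
def negBOut : TopOut datum.EPiN := TopOut.mk _ ⟨negB, negB_mem_contMulAut⟩

/-- **`Out(E^Π_N) → Aut(E^Π_N)`** at the degenerate datum: inner automorphisms of the abelian `E^Π_N` are trivial,
so a class determines its automorphism.  [cite: MochizukiEtTh2009, Def 2.13 (i) p.273 (PDF p.47)] -/
def outLift : TopOut datum.EPiN →* MulAut datum.EPiN :=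
  QuotientGroup.lift (innerContAut datum.EPiN) (contMulAut datum.EPiN).subtype (by
    rintro φ hφ
    rw [Subgroup.mem_subgroupOf] at hφ
    obtain ⟨g, hg⟩ := hφ
    rw [MonoidHom.mem_ker, Subgroup.coe_subtype, ← hg]
    exact MulEquiv.ext fun x => conj_EPiN_apply g x)

/-- `outLift [φ] = φ`. [cite: MochizukiEtTh2009, Def 2.13 (i) p.273 (PDF p.47)] -/
@[simp] theorem outLift_mk (φ : contMulAut datum.EPiN) : outLift (TopOut.mk _ φ) = (φ : MulAut datum.EPiN) := rfl

/-- `outLift` of a transported class: `[e ∘ φ ∘ e⁻¹]`. [cite: MochizukiEtTh2009, Def 2.13 (ii) p.273 (PDF p.47)] -/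
theorem outLift_transport_mk (e : datum.EPiN ≃ₜ* datum.EPiN) (φ : contMulAut datum.EPiN) (x : datum.EPiN) :
    outLift (TopOut.transport e (TopOut.mk _ φ)) x = e ((φ : MulAut datum.EPiN) (e.symm x)) := rfl

/-- The subgroup of `Out(E^Π_N)` of classes (of automorphisms) fixing `x₀ = (1, (0,0,1))`.
[cite: MochizukiEtTh2009, Lem 5.9 (iv) p.332 (PDF p.106)] -/
def fixOut : Subgroup (TopOut datum.EPiN) := (MulAction.stabilizer (MulAut datum.EPiN) x₀).comap outLift

/-- Membership in `fixOut`. [cite: MochizukiEtTh2009, Lem 5.9 (iv) p.332 (PDF p.106)] -/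
theorem mem_fixOut {d : TopOut datum.EPiN} : d ∈ fixOut ↔ outLift d x₀ = x₀ := Iff.rfl

/-- Conjugation by an element of the normaliser of `E^Π_N` in the (abelian) ambient group `Aut_C(B_N) × Π^tp_X̲` fixes
`x₀` — so every element of `galOut` (Lemma 5.9 (iii)) and of `constOut` (Lemma 5.8) lies in `fixOut`.
[cite: MochizukiEtTh2009, Lem 5.9 (iii) p.332 (PDF p.106)] -/
theorem conjOut_mem_fixOut (n : Subgroup.normalizer (datum.EPiN : Set (Aut datum.BN × datum.PiX))) :
    datum.conjOut n ∈ fixOut := by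
  rw [mem_fixOut]
  apply Subtype.ext
  change (n : Aut datum.BN × datum.PiX) * (x₀ : Aut datum.BN × datum.PiX) * (n : Aut datum.BN × datum.PiX)⁻¹ =
    (x₀ : Aut datum.BN × datum.PiX)
  rw [ambient_comm (n : Aut datum.BN × datum.PiX), mul_inv_cancel_right]

/-- `negB` fixes `x₀ = (1, (0,0,1))`. [cite: MochizukiEtTh2009, Lem 5.9 (iv) p.332 (PDF p.106)] -/
theorem negB_x₀ : negB x₀ = x₀ :=
  EPiN_ext (by rw [toPiY_negB, toPiY_x₀]; exact (by decide : (negPi a₀ : Pi) = a₀))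

/-- `[negB] ∈ fixOut`. [cite: MochizukiEtTh2009, Lem 5.9 (iv) p.332 (PDF p.106)] -/
theorem negBOut_mem_fixOut : negBOut ∈ fixOut := negB_x₀

/-- **`D ⊆ fixOut`**: the subgroup `D = ⟨galOut ∪ constOut ∪ DK⟩ ⊆ Out(E^Π_N)` of the Frobenioid-theoretic mono-theta
environment data with `DK := {[negB]}` fixes `x₀`.  [cite: MochizukiEtTh2009, Lem 5.9 (iv) p.332 (PDF p.106)] -/
theorem closure_le_fixOut (h3 : datum.OuterActionLZ) (hsec : datum.SgpCapSection) (h8 : datum.ConstantsEqNormalizer) :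
    Subgroup.closure (datum.galOut h3 hsec ∪ datum.constOut h8 ∪ {negBOut}) ≤ fixOut := by
  rw [Subgroup.closure_le]
  rintro d ((⟨g, rfl⟩ | ⟨u, rfl⟩) | rfl)
  · exact conjOut_mem_fixOut _
  · exact conjOut_mem_fixOut _
  · exact negBOut_mem_fixOut

/-! ### F-0547: the typed Theorem 5.10 (iii) fails at the degenerate datum -/

/-- Conjugation is trivial in the abelian `Π^tp_X̲` of the datum. [cite: MochizukiEtTh2009, Lem 5.9 (iv) p.332 (PDF p.106)] -/
theorem conj_PiX (g y : datum.PiX) : g⁻¹ * y * g = y := by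
  rw [show g⁻¹ * y = y * g⁻¹ from @mul_comm Pi _ _ _, inv_mul_cancel_right]

/-- The concrete inequality behind the counterexample: `shear (negB (shear⁻¹ (0,0,1))) = (0,2,1) ≠ (0,0,1)`.
[cite: MochizukiEtTh2009, Thm 5.10 (iii) p.334 (PDF p.108)] -/
theorem shear_negPi_shear_symm_a₀_ne : shear (negPi (shear.symm a₀)) ≠ a₀ := by decide

/-- **F-0547 at the degenerate datum**: with Kummer part `DK := {[negB]}`, `Ψ := 𝟭`, `β := 𝟙` and `ψY := shear`
(admissible: it stabilises `Π^tp_Y̲`, `Π^tp_Ÿ̲` and lies over `Ψ^Aut`), the typed Theorem 5.10 (iii) statement FAILS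
for all §5 inputs: the `Π^tp_Y`-clause forces `γ` to be the shear on `E^Π_N ≅ Π^tp_Y̲`, and `map_D` would make
`[shear ∘ negB ∘ shear⁻¹]` fix `x₀ = (1,(0,0,1))`, which it moves to `(1,(0,2,1))`.
[cite: MochizukiEtTh2009, Thm 5.10 (iii) p.334 (PDF p.108)] -/
theorem not_monoThetaEnvCompat_datum (h1 : datum.SectionsFactor) (h3 : datum.OuterActionLZ)
    (hsec : datum.SgpCapSection) (hcs : datum.SgpCupSection) (h8 : datum.ConstantsEqNormalizer)
    (Ψ : Discrete PUnit.{1} ≌ Discrete PUnit.{1}) (β : Ψ.functor.obj datum.BN ≅ datum.BN) :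
    ¬ datum.MonoThetaEnvCompat h1 h3 hsec hcs h8 {negBOut} Ψ β shearTop (hbase_datum Ψ β shearTop)
        map_PiY_shearTop map_PiYdd_shearTop := by
  rintro ⟨x₃, γ, -, -, hγ⟩
  -- the `Π^tp_Y`-clause determines `γ.e` on `E^Π_N ≅ Π^tp_Y̲`: it is the shear
  have hγ' : ∀ x : datum.EPiN, datum.toPiY (γ.e x) = shear (datum.toPiY x) := fun x =>
    (hγ x).trans (conj_PiX x₃ _)
  have hγe : γ.e (γ.e.symm x₀) = x₀ := ContinuousMulEquiv.apply_symm_apply γ.e x₀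
  have hsymm : datum.toPiY (γ.e.symm x₀) = shear.symm a₀ := by
    have h0 := hγ' (γ.e.symm x₀)
    rw [hγe, toPiY_x₀] at h0
    exact shear.eq_symm_apply.mpr h0.symm
  -- `map_D`: the transported class of `negB` lies in `D ⊆ fixOut`
  have hmem : negBOut ∈ (datum.frdMonoThetaEnv h1 h3 hsec hcs h8 {negBOut}).D :=
    Subgroup.subset_closure (Or.inr rfl)
  have hT : TopOut.transport γ.e negBOut ∈ (datum.frdMonoThetaEnv h1 h3 hsec hcs h8 {negBOut}).D := by
    rw [← γ.map_D]
    exact Subgroup.mem_map_of_mem _ hmem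
  have hfix : outLift (TopOut.transport γ.e negBOut) x₀ = x₀ := closure_le_fixOut h3 hsec h8 hT
  change γ.e (negB (γ.e.symm x₀)) = x₀ at hfix
  -- read it on the `Π^tp_X̲`-coordinate
  have key := congrArg datum.toPiY hfix
  rw [hγ', toPiY_negB, hsymm, toPiY_x₀] at key
  exact shear_negPi_shear_symm_a₀_ne key

/-- **F-0547: the universal closure of the schema `MonoThetaEnvCompat` is FALSE** (already over §5 data at the
one-object base category): the residual Kummer part `DK ⊆ Out(E^Π_N)` and the automorphism `ψY` are free parameters,
and nothing in the interface ties `DK` to `ψY`.  The instance forms of record — `monoThetaEnvCompat_of_psiAutPreserves`,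
`monoThetaEnvCompat_of_D_eq`, `monoThetaEnvCompat_canonical` (canonical `DK₀`), `monoThetaEnvCompat_kummerOut_iff…` —
are conditional on the printed §5 inputs (Thm. 5.10 (ii), Cor. 2.18 (i)) and are unchanged.  FACT-LIST R5: named
instances only.  [cite: MochizukiEtTh2009, Thm 5.10 (iii) p.334 (PDF p.108)] -/
theorem not_forall_monoThetaEnvCompat :
    ¬ ∀ (C : Type) [Category.{0} C] (D : Type) [Category.{0} D] (𝔉 : ThetaFrobenioid.{0} C D)
        (h1 : 𝔉.SectionsFactor) (h3 : 𝔉.OuterActionLZ) (hsec : 𝔉.SgpCapSection) (hcs : 𝔉.SgpCupSection)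
        (h8 : 𝔉.ConstantsEqNormalizer) (DK : Set (TopOut 𝔉.EPiN)) (Ψ : C ≌ C) (β : Ψ.functor.obj 𝔉.BN ≅ 𝔉.BN)
        (ψY : 𝔉.PiX ≃ₜ* 𝔉.PiX)
        (hbase : ∀ g : 𝔉.PiX, 𝔉.autBase 𝔉.BN (𝔉.psiAut Ψ β (𝔉.sgpCap (𝔉.ρ g))) = 𝔉.ρ (ψY g))
        (hY : 𝔉.PiY.map ψY.toMulEquiv.toMonoidHom = 𝔉.PiY)
        (hYdd : 𝔉.PiYdd.map ψY.toMulEquiv.toMonoidHom = 𝔉.PiYdd),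
        𝔉.MonoThetaEnvCompat h1 h3 hsec hcs h8 DK Ψ β ψY hbase hY hYdd :=
  fun h => not_monoThetaEnvCompat_datum facts_datum.sectionsFactor datum.outerActionLZ_of
    facts_datum.sgpCapSection facts_datum.sgpCupSection facts_datum.constantsEqNormalizer
    (CategoryTheory.Equivalence.refl : Discrete PUnit.{1} ≌ Discrete PUnit.{1}) (Iso.refl _)
    (h _ _ datum _ _ _ _ _ {negBOut} _ _ shearTop _ _ _)

/-! ### Consistency: the typed statement HOLDS at the same datum for `ψY := id` -/

/-- The identity of `Π^tp_X̲` stabilises any subgroup (hypotheses `hY`, `hYdd` for `ψY := id`).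
[cite: MochizukiEtTh2009, Thm 5.10 (iii) p.334 (PDF p.108)] -/
theorem map_refl_eq (K : Subgroup datum.PiX) :
    K.map (ContinuousMulEquiv.refl datum.PiX).toMulEquiv.toMonoidHom = K := by
  ext x
  constructor
  · rintro ⟨y, hy, rfl⟩
    exact hy
  · intro hx
    exact ⟨x, hx, rfl⟩

/-- **CONSISTENCY INSTANCE for F-0547.**  At the degenerate datum, for `ψY := id` and EVERY Kummer part `DK`,
self-equivalence `Ψ` and `β`, the typed Theorem 5.10 (iii) statement HOLDS (`γ := id`, `κ := 1`, `x₃ := 1`; the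
`ϵ`-clause is an identity in the trivial group `Aut_C(B_N)`).  So the predicate takes both truth values on the
interface; the failure above sits in the free pair (`DK`, `ψY`).  [cite: MochizukiEtTh2009, Thm 5.10 (iii) p.334 (PDF p.108)] -/
theorem monoThetaEnvCompat_datum_refl (h1 : datum.SectionsFactor) (h3 : datum.OuterActionLZ)
    (hsec : datum.SgpCapSection) (hcs : datum.SgpCupSection) (h8 : datum.ConstantsEqNormalizer)
    (DK : Set (TopOut datum.EPiN)) (Ψ : Discrete PUnit.{1} ≌ Discrete PUnit.{1})
    (β : Ψ.functor.obj datum.BN ≅ datum.BN) :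
    datum.MonoThetaEnvCompat h1 h3 hsec hcs h8 DK Ψ β (ContinuousMulEquiv.refl datum.PiX)
      (hbase_datum Ψ β _) (map_refl_eq _) (map_refl_eq _) := by
  haveI := subsingleton_aut_BN
  refine ⟨1, MonoThetaEnv.Iso.refl _, 1, fun _ => Subsingleton.elim _ _, fun x => ?_⟩
  change datum.toPiY x = 1⁻¹ * datum.toPiY x * 1
  rw [inv_one, one_mul, mul_one]

end Sec5Toy

end Literature.AnabelianGeometry.EtaleTheta
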